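import Mathlib
import HarnessLib

/-!
# The tube model of the Morse–Bott function of brick F3 (layer `f3_tubeModel`)

Auxiliary file (layer 2) of stub `helper_sliceGluing_bottConstruction` (apex brick F3: the
construction of the Morse–Bott function `F` and of the angular map `α`), line `Sketch`, crux
`SblfDescent.RungOne`.

(Crux item stmt-SmoothPoincare4-18531; skeleton `Cruxes/RungOne/Lines/Sketch.lean`.)

In the `S¹`-parametric fold tube `ν(u, x)` about the round circle (`f ∘ ν = (√(1 - Q²) u, v₂ Q)`,
`Q = x₀² + x₁² - x₂²`) the function of brick F3 reads, with the affine part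
`P(Q) = P₀ - p₀ Q` of the height profile (`helper_f3_profile`) and `cos δ = cos (arctan x₂)
= 1 / √(1 + x₂²)` (the matching of the angular coordinate to the tube),
`F (ν (u, x)) = c₁ g(x)`, `g(x) = (P₀ - p₀ Q(x)) / √(1 + x₂²)`, independently of `u`.
This file is the multivariable calculus of the **tube model** `g` on `EuclideanSpace ℝ (Fin 3)`:

* `hasFDerivAt_tubeModel`: the derivative
  `dg = (P₀ - p₀ Q) φ'(x₂) dx₂ - p₀ (1 + x₂²)^{-1/2} dQ`, `φ(s) = (1 + s²)^{-1/2}`;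
* `fderiv_tubeModel_eq_zero_iff`: in the unit ball, for `0 < p₀`, `4 p₀ ≤ P₀`, the only
  critical point of `g` is the origin (so `Crit F ∩ tube = ν(S¹ × {0})`, the round circle);
* `fderiv_fderiv_tubeModel_zero`: the Hessian at the origin is
  `-2 p₀ (v₀ w₀ + v₁ w₁) + (2 p₀ - P₀) v₂ w₂`, negative definite for `2 p₀ < P₀`
  (`fderiv_fderiv_tubeModel_zero_self_neg`): the Bott condition at the maximum circle;
* `tubeModel_pos`, `tubeModel_lt`: `0 < g < P₀ = g 0` off the origin in the unit ball.

## References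

* J. Milnor, *Morse theory*, Ann. of Math. Studies 51 (1963), §2 (critical points and the
  Hessian in local coordinates). [Milnor1963]
-/

set_option linter.dupNamespace false

noncomputable section

open scoped ContDiff Topology
open Set Filter

namespace Summit.SmoothPoincare4.SmoothPoincare4.Cruxes.RungOne.Sketch

/-! ### Coordinates and the quadratic form `Q` -/

/-- The coordinate functions of `EuclideanSpace ℝ (Fin 3)` have derivative the coordinate projections. [folklore] -/
theorem hasFDerivAt_coord3 (i : Fin 3) (q : EuclideanSpace ℝ (Fin 3)) : HasFDerivAt (fun x : EuclideanSpace ℝ (Fin 3) => x i) ((EuclideanSpace.proj i : EuclideanSpace ℝ (Fin 3) →L[ℝ] ℝ)) q := by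
  have h := (EuclideanSpace.proj i : EuclideanSpace ℝ (Fin 3) →L[ℝ] ℝ).hasFDerivAt (x := q)
  rwa [EuclideanSpace.coe_proj] at h

/-- The derivative of the fold quadratic form `Q = x₀² + x₁² - x₂²`:
`dQ_q = 2 q₀ dx₀ + 2 q₁ dx₁ - 2 q₂ dx₂`. [folklore] -/
theorem hasFDerivAt_foldQ (q : EuclideanSpace ℝ (Fin 3)) :
    HasFDerivAt (fun x : EuclideanSpace ℝ (Fin 3) => x 0 ^ 2 + x 1 ^ 2 - x 2 ^ 2)
      ((2 * q 0) • (EuclideanSpace.proj 0 : EuclideanSpace ℝ (Fin 3) →L[ℝ] ℝ) + (2 * q 1) • (EuclideanSpace.proj 1 : EuclideanSpace ℝ (Fin 3) →L[ℝ] ℝ) - (2 * q 2) • (EuclideanSpace.proj 2 : EuclideanSpace ℝ (Fin 3) →L[ℝ] ℝ)) q := by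
  have h := (((hasFDerivAt_coord3 0 q).pow 2).add ((hasFDerivAt_coord3 1 q).pow 2)).sub
    ((hasFDerivAt_coord3 2 q).pow 2)
  refine h.congr_fderiv ?_
  ext w
  simp

/-- The derivative of the linear-in-`q` covector `dQ_q`: the constant bilinear map
`2 dx₀ ⊗ dx₀ + 2 dx₁ ⊗ dx₁ - 2 dx₂ ⊗ dx₂`. [folklore] -/
theorem hasFDerivAt_foldQ_fderiv (q : EuclideanSpace ℝ (Fin 3)) :
    HasFDerivAt (fun x : EuclideanSpace ℝ (Fin 3) => (2 * x 0) • (EuclideanSpace.proj 0 : EuclideanSpace ℝ (Fin 3) →L[ℝ] ℝ) + (2 * x 1) • (EuclideanSpace.proj 1 : EuclideanSpace ℝ (Fin 3) →L[ℝ] ℝ) - (2 * x 2) • (EuclideanSpace.proj 2 : EuclideanSpace ℝ (Fin 3) →L[ℝ] ℝ))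
      (((2 : ℝ) • (EuclideanSpace.proj 0 : EuclideanSpace ℝ (Fin 3) →L[ℝ] ℝ)).smulRight ((EuclideanSpace.proj 0 : EuclideanSpace ℝ (Fin 3) →L[ℝ] ℝ)) + ((2 : ℝ) • (EuclideanSpace.proj 1 : EuclideanSpace ℝ (Fin 3) →L[ℝ] ℝ)).smulRight ((EuclideanSpace.proj 1 : EuclideanSpace ℝ (Fin 3) →L[ℝ] ℝ)) -
        ((2 : ℝ) • (EuclideanSpace.proj 2 : EuclideanSpace ℝ (Fin 3) →L[ℝ] ℝ)).smulRight ((EuclideanSpace.proj 2 : EuclideanSpace ℝ (Fin 3) →L[ℝ] ℝ))) q :=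
  ((((hasFDerivAt_coord3 0 q).const_mul 2).smul_const ((EuclideanSpace.proj 0 : EuclideanSpace ℝ (Fin 3) →L[ℝ] ℝ))).add
    (((hasFDerivAt_coord3 1 q).const_mul 2).smul_const ((EuclideanSpace.proj 1 : EuclideanSpace ℝ (Fin 3) →L[ℝ] ℝ)))).sub
    (((hasFDerivAt_coord3 2 q).const_mul 2).smul_const ((EuclideanSpace.proj 2 : EuclideanSpace ℝ (Fin 3) →L[ℝ] ℝ)))

/-! ### The factor `φ(s) = (1 + s²)^{-1/2}` -/

/-- The derivative of `φ(s) = 1 / √(1 + s²)`: `φ'(s) = -s / ((1 + s²) √(1 + s²))`. [folklore] -/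
theorem hasDerivAt_invSqrtOneAddSq (s : ℝ) :
    HasDerivAt (fun s : ℝ => (√(1 + s ^ 2))⁻¹) (-(s / ((1 + s ^ 2) * √(1 + s ^ 2)))) s := by
  have hw : 0 < 1 + s ^ 2 := by positivity
  have hr : 0 < √(1 + s ^ 2) := Real.sqrt_pos.2 hw
  have h1 : HasDerivAt (fun s : ℝ => 1 + s ^ 2) (2 * s) s := by
    simpa using (hasDerivAt_pow 2 s).const_add 1
  have h2 : HasDerivAt (fun s : ℝ => √(1 + s ^ 2)) (1 / (2 * √(1 + s ^ 2)) * (2 * s)) s :=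
    (Real.hasDerivAt_sqrt hw.ne').comp s h1
  have h3 := h2.inv hr.ne'
  have key : -(1 / (2 * √(1 + s ^ 2)) * (2 * s)) / √(1 + s ^ 2) ^ 2 =
      -(s / ((1 + s ^ 2) * √(1 + s ^ 2))) := by
    rw [Real.sq_sqrt hw.le]
    field_simp
  exact h3.congr_deriv key

/-- The derivative of `φ'` at `0` is `φ''(0) = -1`. [folklore] -/
theorem hasDerivAt_deriv_invSqrtOneAddSq_zero :
    HasDerivAt (fun s : ℝ => -(s / ((1 + s ^ 2) * √(1 + s ^ 2)))) (-1) 0 := by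
  have h1 : HasDerivAt (fun s : ℝ => 1 + s ^ 2) (2 * (0 : ℝ)) 0 := by
    simpa using (hasDerivAt_pow 2 (0 : ℝ)).const_add 1
  have h2 : HasDerivAt (fun s : ℝ => √(1 + s ^ 2)) (1 / (2 * √(1 + (0 : ℝ) ^ 2)) * (2 * 0)) 0 :=
    (Real.hasDerivAt_sqrt (by norm_num)).comp (0 : ℝ) h1
  have hd := h1.mul h2
  have h := ((hasDerivAt_id' (0 : ℝ)).div hd (by norm_num)).neg
  refine h.congr_deriv ?_
  norm_num

/-! ### The tube model `g(x) = (P₀ - p₀ Q(x)) / √(1 + x₂²)` -/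

/-- **The derivative of the tube model**:
`dg_q = (P₀ - p₀ Q(q)) φ'(q₂) dx₂ + (1 + q₂²)^{-1/2} (-p₀ dQ_q)`. [folklore] -/
theorem hasFDerivAt_tubeModel (P₀ p₀ : ℝ) (q : EuclideanSpace ℝ (Fin 3)) :
    HasFDerivAt (fun x : EuclideanSpace ℝ (Fin 3) => (P₀ - p₀ * (x 0 ^ 2 + x 1 ^ 2 - x 2 ^ 2)) / √(1 + x 2 ^ 2))
      ((P₀ - p₀ * (q 0 ^ 2 + q 1 ^ 2 - q 2 ^ 2)) •
          ((-(q 2 / ((1 + q 2 ^ 2) * √(1 + q 2 ^ 2)))) • (EuclideanSpace.proj 2 : EuclideanSpace ℝ (Fin 3) →L[ℝ] ℝ)) +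
        (√(1 + q 2 ^ 2))⁻¹ • -(p₀ • ((2 * q 0) • (EuclideanSpace.proj 0 : EuclideanSpace ℝ (Fin 3) →L[ℝ] ℝ) + (2 * q 1) • (EuclideanSpace.proj 1 : EuclideanSpace ℝ (Fin 3) →L[ℝ] ℝ) - (2 * q 2) • (EuclideanSpace.proj 2 : EuclideanSpace ℝ (Fin 3) →L[ℝ] ℝ)))) q := by
  have hA : HasFDerivAt (fun x : EuclideanSpace ℝ (Fin 3) => P₀ - p₀ * (x 0 ^ 2 + x 1 ^ 2 - x 2 ^ 2))
      (-(p₀ • ((2 * q 0) • (EuclideanSpace.proj 0 : EuclideanSpace ℝ (Fin 3) →L[ℝ] ℝ) + (2 * q 1) • (EuclideanSpace.proj 1 : EuclideanSpace ℝ (Fin 3) →L[ℝ] ℝ) - (2 * q 2) • (EuclideanSpace.proj 2 : EuclideanSpace ℝ (Fin 3) →L[ℝ] ℝ)))) q :=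
    ((hasFDerivAt_foldQ q).const_mul p₀).const_sub P₀
  have hB := (hasDerivAt_invSqrtOneAddSq (q 2)).comp_hasFDerivAt q (hasFDerivAt_coord3 2 q)
  refine (hA.mul hB).congr_of_eventuallyEq (Eventually.of_forall fun x => ?_)
  simp only [div_eq_mul_inv, Pi.mul_apply, Function.comp_apply]

/-- The tube model is smooth. [folklore] -/
theorem contDiff_tubeModel (P₀ p₀ : ℝ) :
    ContDiff ℝ ∞ (fun x : EuclideanSpace ℝ (Fin 3) => (P₀ - p₀ * (x 0 ^ 2 + x 1 ^ 2 - x 2 ^ 2)) / √(1 + x 2 ^ 2)) := by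
  have hc : ∀ i : Fin 3, ContDiff ℝ ∞ (fun x : EuclideanSpace ℝ (Fin 3) => x i) := fun i =>
    (EuclideanSpace.proj i : EuclideanSpace ℝ (Fin 3) →L[ℝ] ℝ).contDiff
  refine ContDiff.div ?_ ?_ fun x => (Real.sqrt_pos.2 (by positivity)).ne'
  · exact contDiff_const.sub (contDiff_const.mul ((((hc 0).pow 2).add ((hc 1).pow 2)).sub
      ((hc 2).pow 2)))
  · exact (contDiff_const.add ((hc 2).pow 2)).sqrt fun x => (by positivity : (1 : ℝ) + x 2 ^ 2 ≠ 0)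

/-- The value of the tube model at the origin is `P₀`. [folklore] -/
theorem tubeModel_zero (P₀ p₀ : ℝ) :
    (fun x : EuclideanSpace ℝ (Fin 3) => (P₀ - p₀ * (x 0 ^ 2 + x 1 ^ 2 - x 2 ^ 2)) / √(1 + x 2 ^ 2)) 0 = P₀ := by simp

/-- **Positivity of the tube model** in the unit ball (`0 < p₀ ≤ P₀`). [folklore] -/
theorem tubeModel_pos {P₀ p₀ : ℝ} (hp : 0 < p₀) (hP : p₀ ≤ P₀) {x : EuclideanSpace ℝ (Fin 3)} (hx : ‖x‖ < 1) :
    0 < (P₀ - p₀ * (x 0 ^ 2 + x 1 ^ 2 - x 2 ^ 2)) / √(1 + x 2 ^ 2) := by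
  have hn : ‖x‖ ^ 2 = x 0 ^ 2 + x 1 ^ 2 + x 2 ^ 2 := by
    rw [EuclideanSpace.norm_sq_eq]; simp [Fin.sum_univ_three, sq_abs]
  have hx1 : ‖x‖ ^ 2 < 1 := by nlinarith [norm_nonneg x]
  refine div_pos ?_ (Real.sqrt_pos.2 (by positivity))
  nlinarith [sq_nonneg (x 2)]

/-- **The tube model is below its central value** `P₀` off the origin in the unit ball
(`0 < p₀`, `4 p₀ ≤ P₀`): the maximum circle. [folklore] -/
theorem tubeModel_lt {P₀ p₀ : ℝ} (hp : 0 < p₀) (hP : 4 * p₀ ≤ P₀) {x : EuclideanSpace ℝ (Fin 3)} (hx : ‖x‖ < 1)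
    (hx0 : x ≠ 0) : (P₀ - p₀ * (x 0 ^ 2 + x 1 ^ 2 - x 2 ^ 2)) / √(1 + x 2 ^ 2) < P₀ := by
  have hn : ‖x‖ ^ 2 = x 0 ^ 2 + x 1 ^ 2 + x 2 ^ 2 := by
    rw [EuclideanSpace.norm_sq_eq]; simp [Fin.sum_univ_three, sq_abs]
  have hx1 : ‖x‖ ^ 2 < 1 := by nlinarith [norm_nonneg x]
  have hw : 0 < 1 + x 2 ^ 2 := by positivity
  have hr : 0 < √(1 + x 2 ^ 2) := Real.sqrt_pos.2 hw
  have hr2 : √(1 + x 2 ^ 2) ^ 2 = 1 + x 2 ^ 2 := Real.sq_sqrt hw.le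
  have hP0 : 0 < P₀ := by linarith
  rw [div_lt_iff₀ hr]
  have hne : 0 < x 0 ^ 2 + x 1 ^ 2 + x 2 ^ 2 := by
    rcases (norm_nonneg x).eq_or_lt with h0 | h0
    · exact absurd (norm_eq_zero.1 h0.symm) hx0
    · nlinarith
  by_cases h2 : x 2 = 0
  · -- then `x₀² + x₁² > 0` and `√(1 + 0) = 1`
    have h01 : 0 < x 0 ^ 2 + x 1 ^ 2 := by simpa [h2] using hne
    have : √(1 + x 2 ^ 2) = 1 := by rw [h2]; simp
    rw [this, h2]
    nlinarith [mul_pos hp h01]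
  · have hs : 0 < x 2 ^ 2 := by positivity
    have hs1 : x 2 ^ 2 < 1 := by nlinarith [sq_nonneg (x 0), sq_nonneg (x 1)]
    -- `(P₀ + p₀ s)² < P₀² (1 + s)` for `0 < s < 1`, `4 p₀ ≤ P₀`
    have hA : 2 * P₀ * p₀ + p₀ ^ 2 * x 2 ^ 2 < P₀ ^ 2 := by
      nlinarith [mul_pos hp hp, mul_le_mul_of_nonneg_left hP hp.le, mul_pos (mul_pos hp hp) hs]
    have hlt : P₀ + p₀ * x 2 ^ 2 < P₀ * √(1 + x 2 ^ 2) := by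
      have hsq : (P₀ + p₀ * x 2 ^ 2) ^ 2 < (P₀ * √(1 + x 2 ^ 2)) ^ 2 := by
        rw [mul_pow, hr2]
        nlinarith [mul_pos hs (sub_pos.2 hA)]
      exact lt_of_pow_lt_pow_left₀ 2 (by positivity) hsq
    nlinarith [mul_nonneg hp.le (add_nonneg (sq_nonneg (x 0)) (sq_nonneg (x 1)))]

/-- **Critical points of the tube model**: in the unit ball, for `0 < p₀`, `4 p₀ ≤ P₀`, the
derivative of `g` vanishes exactly at the origin (`∂₀ g = -2 p₀ x₀ φ`, `∂₁ g = -2 p₀ x₁ φ`,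
`∂₂ g = x₂ φ³ (p₀ (2 + ‖x‖²) - P₀)`). [folklore] -/
theorem fderiv_tubeModel_eq_zero_iff {P₀ p₀ : ℝ} (hp : 0 < p₀) (hP : 4 * p₀ ≤ P₀) {x : EuclideanSpace ℝ (Fin 3)}
    (hx : ‖x‖ < 1) :
    fderiv ℝ (fun x : EuclideanSpace ℝ (Fin 3) => (P₀ - p₀ * (x 0 ^ 2 + x 1 ^ 2 - x 2 ^ 2)) / √(1 + x 2 ^ 2)) x = 0 ↔
      x = 0 := by
  rw [(hasFDerivAt_tubeModel P₀ p₀ x).fderiv]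
  have hn : ‖x‖ ^ 2 = x 0 ^ 2 + x 1 ^ 2 + x 2 ^ 2 := by
    rw [EuclideanSpace.norm_sq_eq]; simp [Fin.sum_univ_three, sq_abs]
  have hx1 : ‖x‖ ^ 2 < 1 := by nlinarith [norm_nonneg x]
  have hw : 0 < 1 + x 2 ^ 2 := by positivity
  have hr : 0 < √(1 + x 2 ^ 2) := Real.sqrt_pos.2 hw
  have hr2 : √(1 + x 2 ^ 2) ^ 2 = 1 + x 2 ^ 2 := Real.sq_sqrt hw.le
  constructor
  · intro h
    have e0 := congrArg (fun L : EuclideanSpace ℝ (Fin 3) →L[ℝ] ℝ => L (EuclideanSpace.single 0 1)) h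
    have e1 := congrArg (fun L : EuclideanSpace ℝ (Fin 3) →L[ℝ] ℝ => L (EuclideanSpace.single 1 1)) h
    have e2 := congrArg (fun L : EuclideanSpace ℝ (Fin 3) →L[ℝ] ℝ => L (EuclideanSpace.single 2 1)) h
    simp at e0 e1 e2
    have hx0 : x 0 = 0 := by
      rcases e0 with h0 | h0 | h0
      · exact absurd h0 hr.ne'
      · exact absurd h0 hp.ne'
      · exact h0
    have hx1' : x 1 = 0 := by
      rcases e1 with h0 | h0 | h0
      · exact absurd h0 hr.ne'
      · exact absurd h0 hp.ne'
      · exact h0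
    rw [hx0, hx1'] at e2
    have hw' : (1 : ℝ) + x 2 ^ 2 ≠ 0 := hw.ne'
    have hr' : √(1 + x 2 ^ 2) ≠ 0 := hr.ne'
    field_simp at e2
    have key : x 2 * (2 * p₀ + p₀ * x 2 ^ 2 - P₀) = 0 := by linear_combination e2
    have hx2 : x 2 = 0 := by
      rcases mul_eq_zero.1 key with h0 | h0
      · exact h0
      · exfalso
        have hs : x 2 ^ 2 < 1 := by nlinarith [sq_nonneg (x 0), sq_nonneg (x 1)]
        nlinarith [mul_pos hp (sub_pos.2 hs)]
    ext i
    fin_cases i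
    · exact hx0
    · exact hx1'
    · exact hx2
  · rintro rfl
    ext w
    simp

/-- **The Hessian of the tube model at the origin**:
`D²g(0)(v, w) = -2 p₀ (v₀ w₀ + v₁ w₁) + (2 p₀ - P₀) v₂ w₂`. [folklore] -/
theorem fderiv_fderiv_tubeModel_zero (P₀ p₀ : ℝ) (v w : EuclideanSpace ℝ (Fin 3)) :
    fderiv ℝ (fderiv ℝ (fun x : EuclideanSpace ℝ (Fin 3) => (P₀ - p₀ * (x 0 ^ 2 + x 1 ^ 2 - x 2 ^ 2)) / √(1 + x 2 ^ 2)))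
      0 v w = -2 * p₀ * (v 0 * w 0 + v 1 * w 1) + (2 * p₀ - P₀) * (v 2 * w 2) := by
  -- the first derivative as a function
  have hfd : fderiv ℝ (fun x : EuclideanSpace ℝ (Fin 3) => (P₀ - p₀ * (x 0 ^ 2 + x 1 ^ 2 - x 2 ^ 2)) / √(1 + x 2 ^ 2)) =
      fun q : EuclideanSpace ℝ (Fin 3) => (P₀ - p₀ * (q 0 ^ 2 + q 1 ^ 2 - q 2 ^ 2)) •
          ((-(q 2 / ((1 + q 2 ^ 2) * √(1 + q 2 ^ 2)))) • (EuclideanSpace.proj 2 : EuclideanSpace ℝ (Fin 3) →L[ℝ] ℝ)) +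
        (√(1 + q 2 ^ 2))⁻¹ • -(p₀ • ((2 * q 0) • (EuclideanSpace.proj 0 : EuclideanSpace ℝ (Fin 3) →L[ℝ] ℝ) + (2 * q 1) • (EuclideanSpace.proj 1 : EuclideanSpace ℝ (Fin 3) →L[ℝ] ℝ) - (2 * q 2) • (EuclideanSpace.proj 2 : EuclideanSpace ℝ (Fin 3) →L[ℝ] ℝ))) :=
    funext fun q => (hasFDerivAt_tubeModel P₀ p₀ q).fderiv
  rw [hfd]
  -- differentiate the two terms at `0`
  have hA : HasFDerivAt (fun x : EuclideanSpace ℝ (Fin 3) => P₀ - p₀ * (x 0 ^ 2 + x 1 ^ 2 - x 2 ^ 2))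
      (-(p₀ • ((2 * (0 : EuclideanSpace ℝ (Fin 3)) 0) • (EuclideanSpace.proj 0 : EuclideanSpace ℝ (Fin 3) →L[ℝ] ℝ) + (2 * (0 : EuclideanSpace ℝ (Fin 3)) 1) • (EuclideanSpace.proj 1 : EuclideanSpace ℝ (Fin 3) →L[ℝ] ℝ) - (2 * (0 : EuclideanSpace ℝ (Fin 3)) 2) • (EuclideanSpace.proj 2 : EuclideanSpace ℝ (Fin 3) →L[ℝ] ℝ)))) 0 :=
    ((hasFDerivAt_foldQ 0).const_mul p₀).const_sub P₀
  have hφ' := hasDerivAt_deriv_invSqrtOneAddSq_zero.comp_hasFDerivAt_of_eq (0 : EuclideanSpace ℝ (Fin 3))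
      (hasFDerivAt_coord3 2 (0 : EuclideanSpace ℝ (Fin 3))) (by simp)
  have hT := hφ'.smul_const ((EuclideanSpace.proj 2 : EuclideanSpace ℝ (Fin 3) →L[ℝ] ℝ))
  have hB := (hasDerivAt_invSqrtOneAddSq ((0 : EuclideanSpace ℝ (Fin 3)) 2)).comp_hasFDerivAt 0 (hasFDerivAt_coord3 2 0)
  have hS : HasFDerivAt (fun x : EuclideanSpace ℝ (Fin 3) => -(p₀ • ((2 * x 0) • (EuclideanSpace.proj 0 : EuclideanSpace ℝ (Fin 3) →L[ℝ] ℝ) + (2 * x 1) • (EuclideanSpace.proj 1 : EuclideanSpace ℝ (Fin 3) →L[ℝ] ℝ) - (2 * x 2) • (EuclideanSpace.proj 2 : EuclideanSpace ℝ (Fin 3) →L[ℝ] ℝ))))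
      (-(p₀ • (((2 : ℝ) • (EuclideanSpace.proj 0 : EuclideanSpace ℝ (Fin 3) →L[ℝ] ℝ)).smulRight ((EuclideanSpace.proj 0 : EuclideanSpace ℝ (Fin 3) →L[ℝ] ℝ)) + ((2 : ℝ) • (EuclideanSpace.proj 1 : EuclideanSpace ℝ (Fin 3) →L[ℝ] ℝ)).smulRight ((EuclideanSpace.proj 1 : EuclideanSpace ℝ (Fin 3) →L[ℝ] ℝ)) -
        ((2 : ℝ) • (EuclideanSpace.proj 2 : EuclideanSpace ℝ (Fin 3) →L[ℝ] ℝ)).smulRight ((EuclideanSpace.proj 2 : EuclideanSpace ℝ (Fin 3) →L[ℝ] ℝ))))) 0 :=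
    ((hasFDerivAt_foldQ_fderiv 0).const_smul p₀).neg
  have h := (hA.smul hT).add (hB.smul hS)
  have h' : HasFDerivAt (fun q : EuclideanSpace ℝ (Fin 3) => (P₀ - p₀ * (q 0 ^ 2 + q 1 ^ 2 - q 2 ^ 2)) •
          ((-(q 2 / ((1 + q 2 ^ 2) * √(1 + q 2 ^ 2)))) • (EuclideanSpace.proj 2 : EuclideanSpace ℝ (Fin 3) →L[ℝ] ℝ)) +
        (√(1 + q 2 ^ 2))⁻¹ • -(p₀ • ((2 * q 0) • (EuclideanSpace.proj 0 : EuclideanSpace ℝ (Fin 3) →L[ℝ] ℝ) + (2 * q 1) • (EuclideanSpace.proj 1 : EuclideanSpace ℝ (Fin 3) →L[ℝ] ℝ) - (2 * q 2) • (EuclideanSpace.proj 2 : EuclideanSpace ℝ (Fin 3) →L[ℝ] ℝ)))) _ 0 :=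
    h.congr_of_eventuallyEq (Eventually.of_forall fun y => by
      simp only [Pi.add_apply, Pi.smul_apply', Function.comp_apply])
  rw [h'.fderiv]
  simp
  ring

/-- **The Bott condition in the tube**: for `0 < p₀`, `2 p₀ < P₀` the Hessian of the tube model
at the origin is negative definite. [folklore] -/
theorem fderiv_fderiv_tubeModel_zero_self_neg {P₀ p₀ : ℝ} (hp : 0 < p₀) (hP : 2 * p₀ < P₀)
    {w : EuclideanSpace ℝ (Fin 3)} (hw : w ≠ 0) :
    fderiv ℝ (fderiv ℝ (fun x : EuclideanSpace ℝ (Fin 3) => (P₀ - p₀ * (x 0 ^ 2 + x 1 ^ 2 - x 2 ^ 2)) / √(1 + x 2 ^ 2)))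
      0 w w < 0 := by
  rw [fderiv_fderiv_tubeModel_zero]
  have hn : ‖w‖ ^ 2 = w 0 ^ 2 + w 1 ^ 2 + w 2 ^ 2 := by
    rw [EuclideanSpace.norm_sq_eq]; simp [Fin.sum_univ_three, sq_abs]
  have hne : 0 < w 0 ^ 2 + w 1 ^ 2 + w 2 ^ 2 := by
    rcases (norm_nonneg w).eq_or_lt with h0 | h0
    · exact absurd (norm_eq_zero.1 h0.symm) hw
    · nlinarith
  by_cases h2 : w 2 = 0
  · have h01 : 0 < w 0 ^ 2 + w 1 ^ 2 := by simpa [h2] using hne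
    rw [h2]
    nlinarith [mul_pos hp h01]
  · have hs : 0 < w 2 ^ 2 := by positivity
    nlinarith [mul_pos (sub_pos.2 hP) hs,
      mul_nonneg hp.le (add_nonneg (sq_nonneg (w 0)) (sq_nonneg (w 1)))]

/-- **Layer `f3_tubeModel` of brick F3: the tube model of the Morse–Bott function.**  For
`0 < p₀`, `4 p₀ ≤ P₀` the function `g(x) = (P₀ - p₀ (x₀² + x₁² - x₂²)) / √(1 + x₂²)` on `EuclideanSpace ℝ (Fin 3)`
(the function of brick F3 read in the `S¹`-parametric fold tube about the round circle, up to
the positive factor `c₁` and independently of the circle coordinate) is smooth, has the origin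
as its only critical point in the unit ball, has Hessian
`-2 p₀ (v₀ w₀ + v₁ w₁) + (2 p₀ - P₀) v₂ w₂` at the origin (negative definite: the Bott
condition at the maximum circle), and satisfies `0 < g < P₀ = g(0)` off the origin in the
unit ball (Milnor 1963, §2: critical points and the Hessian in local coordinates).
[cite: Milnor1963, §2] -/
theorem helper_f3_tubeModel : ∀ (P₀ p₀ : ℝ), 0 < p₀ → 4 * p₀ ≤ P₀ → ContDiff ℝ ∞ (fun x : EuclideanSpace ℝ (Fin 3) => (P₀ - p₀ * (x 0 ^ 2 + x 1 ^ 2 - x 2 ^ 2)) / √(1 + x 2 ^ 2)) ∧ (∀ x : EuclideanSpace ℝ (Fin 3), ‖x‖ < 1 → (fderiv ℝ (fun x : EuclideanSpace ℝ (Fin 3) => (P₀ - p₀ * (x 0 ^ 2 + x 1 ^ 2 - x 2 ^ 2)) / √(1 + x 2 ^ 2)) x = 0 ↔ x = 0)) ∧ (∀ v w : EuclideanSpace ℝ (Fin 3), fderiv ℝ (fderiv ℝ (fun x : EuclideanSpace ℝ (Fin 3) => (P₀ - p₀ * (x 0 ^ 2 + x 1 ^ 2 - x 2 ^ 2)) /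 √(1 + x 2 ^ 2))) 0 v w = -2 * p₀ * (v 0 * w 0 + v 1 * w 1) + (2 * p₀ - P₀) * (v 2 * w 2)) ∧ (∀ w : EuclideanSpace ℝ (Fin 3), w ≠ 0 → fderiv ℝ (fderiv ℝ (fun x : EuclideanSpace ℝ (Fin 3) => (P₀ - p₀ * (x 0 ^ 2 + x 1 ^ 2 - x 2 ^ 2)) / √(1 + x 2 ^ 2))) 0 w w < 0) ∧ (∀ x : EuclideanSpace ℝ (Fin 3), ‖x‖ < 1 → 0 < (P₀ - p₀ * (x 0 ^ 2 + x 1 ^ 2 - x 2 ^ 2)) / √(1 + x 2 ^ 2)) ∧ (∀ x : EuclideanSpace ℝ (Fin 3), ‖x‖ < 1 → x ≠ 0 → (P₀ - p₀ * (x 0 ^ 2 + x 1 ^ 2 - x 2 ^ 2)) / √(1 + x 2 ^ 2) < P₀) := by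
  intro P₀ p₀ hp hP
  have hP2 : 2 * p₀ < P₀ := by linarith
  exact ⟨contDiff_tubeModel P₀ p₀, fun x hx => fderiv_tubeModel_eq_zero_iff hp hP hx,
    fderiv_fderiv_tubeModel_zero P₀ p₀, fun w hw => fderiv_fderiv_tubeModel_zero_self_neg hp hP2 hw,
    fun x hx => tubeModel_pos hp (by linarith) hx, fun x hx hx0 => tubeModel_lt hp hP hx hx0⟩

end Summit.SmoothPoincare4.SmoothPoincare4.Cruxes.RungOne.Sketch

end
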